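/-
Adjudication Team R (D-0069 campaign, cell siegel-zhang): kernel refutation of the AS-PRINTED
proof step `Z22:§11.u014` (GAP-LEDGER row G-num6-1; printed-false-pointwise). The printed display
"by (6.2), `∫_{0.502}^{2u−0.504} g(P^z/y)dz = 2u − 1.006 + O(ε)`" (case B of the proof of (11.2),
[Z22 p.64, tex L3270–L3273]) is FALSE as printed: on this range `(4.3)` forces the integral to be
`O(ε)` while the claimed main term `2u − 1.006` is of size `≈ 0.002` at the top of case B. The
corrected step (`Typed.Sec11A.StepU014corr`, what the case-B assembly of (11.2) actually consumes)
is NOT touched here — it belongs to the discharge lane. Nothing here is a claim about Lemma 11.1,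
(11.2), Theorems 1–2, or Landau–Siegel zeros: this file refutes ONE typed-as-printed proof-internal
display, in support of the GAP-LEDGER class «printed-false-pointwise: state both, cite the kernel
certificate».
-/
import Literature.NumberTheory.LFunctions.Zhang2022.TypedSection11A
import Literature.NumberTheory.LFunctions.Zhang2022.SkeletonReductions
import Literature.NumberTheory.EllipticCurves.RootNumberTwistProofs

/-! # Team R: `¬ StepU014` — the printed `§11.u014` display is false as printed

`Typed.Sec11A.StepU014` types the display verbatim: `∃ c > 0, ∃ C`, for all large `D` (quadratic
primitive `χ`, unused) and all `y` in case B (`P^{0.503} ≤ y ≤ P^{0.504}η₋`),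
`|∫_{0.502}^{2u−0.504} g(P^z/y)dz − (2u − 1.006)| ≤ C·exp(−c𝓛¹⁰)`.

Refutation witness: `y = P^{0.504}η₋` (the top of case B), where `u = 0.504 − 𝓛⁻¹⁹`, the claimed
main term is `2u − 1.006 = 0.002 − 2𝓛⁻¹⁹`, while on the whole integration range `z ≤ 2u − 0.504`
one has `P^z/y ≤ exp(−𝓛⁻¹⁰) < 1`, so `(4.3)` (tree `GaussWeight.gWeight_le`) gives
`g(P^z/y) ≤ ½exp(−𝓛¹⁰)` and `|∫| ≤ 0.001·exp(−𝓛¹⁰)`: the defect is `≥ 0.0005` for `𝓛 ≥ 2000`,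
beating every allowance `C·exp(−c𝓛¹⁰)` for `D` large. The quantifier `ForAllLarge` is refuted by
exhibiting, above every threshold, an odd prime `p` with the quadratic primitive character
`(·/p) ⊗ ℂ` (tree `isPrimitive_quadraticChar_ringHomComp`, `isQuadratic_quadraticChar_ringHomComp`)
— the reusable witness-family for refuting any false χ-free-body `ForAllLarge` statement.
-/

namespace Literature.NumberTheory.LFunctions.Zhang2022.AdjTeamR

open Literature.NumberTheory.LFunctions.Zhang2022
open Literature.NumberTheory.LFunctions.Zhang2022.Skeleton
open Literature.NumberTheory.LFunctions.Zhang2022.Typed.Sec11A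
open Literature.NumberTheory.EllipticCurves.ModularForms
open Real

/-- `P^z = exp(z·𝓛⁹)` (`log P = 𝓛⁹`, (2.6)). [cite: Zhang2022LandauSiegel, §2 (2.6)] -/
private theorem bigP_rpow (D : ℕ) (z : ℝ) : bigP D ^ z = Real.exp (z * ell D ^ 9) := by
  rw [Real.rpow_def_of_pos (by rw [bigP]; exact Real.exp_pos _), log_bigP, mul_comm]

/-- `log(P^{0.504}η₋) = 0.504·𝓛⁹ − (𝓛¹⁰)⁻¹`. [cite: Zhang2022LandauSiegel, §11 p. 64] -/
private theorem log_witness (D : ℕ) :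
    Real.log (bigP D ^ (0.504 : ℝ) * etaPM D (-1)) = 0.504 * ell D ^ 9 - (ell D ^ 10)⁻¹ := by
  have hP : (0 : ℝ) < bigP D ^ (0.504 : ℝ) := by
    rw [bigP_rpow]; exact Real.exp_pos _
  have hE : (0 : ℝ) < etaPM D (-1) := by rw [etaPM]; exact Real.exp_pos _
  rw [Real.log_mul hP.ne' hE.ne', bigP_rpow, Real.log_exp, etaPM, Real.log_exp]
  ring

/-- `u(P^{0.504}η₋) = 0.504 − (𝓛¹⁹)⁻¹` for `𝓛 > 0`. [cite: Zhang2022LandauSiegel, §11 p. 64] -/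
private theorem uOf_witness (D : ℕ) (hL : 0 < ell D) :
    uOf D (bigP D ^ (0.504 : ℝ) * etaPM D (-1)) = 0.504 - (ell D ^ 19)⁻¹ := by
  have h9 : (ell D ^ 9 : ℝ) ≠ 0 := by positivity
  have h10 : (ell D ^ 10 : ℝ) ≠ 0 := by positivity
  have h19 : (ell D ^ 19 : ℝ) ≠ 0 := by positivity
  rw [uOf, log_witness, log_bigP]
  field_simp

/-- The witness `y = P^{0.504}η₋` is in case B once `𝓛 ≥ 2000`.
[cite: Zhang2022LandauSiegel, §11 p. 64, tex L3266] -/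
private theorem witness_caseB (D : ℕ) (h2000 : 2000 ≤ ell D) :
    CaseB D (bigP D ^ (0.504 : ℝ) * etaPM D (-1)) := by
  have hL : (0 : ℝ) < ell D := by linarith
  have hL1 : (1 : ℝ) ≤ ell D := by linarith
  have h10 : (1 : ℝ) ≤ ell D ^ 10 := one_le_pow₀ hL1
  constructor
  · -- `P^{0.503} ≤ P^{0.504}·exp(−(𝓛¹⁰)⁻¹)`
    rw [bigP_rpow, bigP_rpow, etaPM, ← Real.exp_add, Real.exp_le_exp]
    have hinv : (ell D ^ 10)⁻¹ ≤ 1 := by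
      rw [inv_le_one_iff₀]; right; exact h10
    have h9 : (2000 : ℝ) ≤ ell D ^ 9 :=
      le_trans h2000 (le_self_pow₀ hL1 (by norm_num))
    nlinarith
  · exact le_refl _

/-- On the whole case-B-witness integration range, the integrand is `≤ ½·exp(−𝓛¹⁰)`: the printed
claim's own range forces `P^z/y ≤ exp(−𝓛⁻¹⁰)` and (4.3) (`gWeight_le`) bites.
[cite: Zhang2022LandauSiegel, §4 (4.3); §11 p. 64] -/
private theorem integrand_le (D : ℕ) (h2000 : 2000 ≤ ell D) {z : ℝ}
    (hz : z ∈ Set.uIoc (0.502 : ℝ)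
      (2 * uOf D (bigP D ^ (0.504 : ℝ) * etaPM D (-1)) - 0.504)) :
    ‖gW D (bigP D ^ z / (bigP D ^ (0.504 : ℝ) * etaPM D (-1)))‖ ≤
      (1 / 2) * Real.exp (-(ell D ^ 10)) := by
  have hL : (0 : ℝ) < ell D := by linarith
  have hL1 : (1 : ℝ) ≤ ell D := by linarith
  have hΛ : (0 : ℝ) < ell D ^ 30 := by positivity
  have h19 : (0 : ℝ) < ell D ^ 19 := by positivity
  have h10 : (0 : ℝ) < ell D ^ 10 := by positivity
  have h2000p : (2000 : ℝ) ≤ ell D ^ 19 := le_trans h2000 (le_self_pow₀ hL1 (by norm_num))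
  have hinv19 : (ell D ^ 19)⁻¹ ≤ 1 / 2000 := by
    rw [inv_le_comm₀ h19 (by norm_num)]; linarith
  -- the upper endpoint and the range bound on `z`
  have hu := uOf_witness D hL
  have hzb : z ≤ 2 * uOf D (bigP D ^ (0.504 : ℝ) * etaPM D (-1)) - 0.504 := by
    have hab : (0.502 : ℝ) < 2 * uOf D (bigP D ^ (0.504 : ℝ) * etaPM D (-1)) - 0.504 := by
      rw [hu]; nlinarith
    have := hz.2
    rwa [max_eq_right hab.le] at this
  -- the argument of `g` and its logarithm
  have hy : (0 : ℝ) < bigP D ^ (0.504 : ℝ) * etaPM D (-1) := by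
    have : (0 : ℝ) < bigP D ^ (0.504 : ℝ) := by rw [bigP_rpow]; exact Real.exp_pos _
    have hE : (0 : ℝ) < etaPM D (-1) := by rw [etaPM]; exact Real.exp_pos _
    positivity
  set x : ℝ := bigP D ^ z / (bigP D ^ (0.504 : ℝ) * etaPM D (-1)) with hxdef
  have hx : (0 : ℝ) < x := by
    have : (0 : ℝ) < bigP D ^ z := by rw [bigP_rpow]; exact Real.exp_pos _
    exact div_pos this hy
  have hlogx : Real.log x =
      (z - uOf D (bigP D ^ (0.504 : ℝ) * etaPM D (-1))) * ell D ^ 9 := by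
    have h9 : (ell D ^ 9 : ℝ) ≠ 0 := by positivity
    have hPz : (0 : ℝ) < bigP D ^ z := by rw [bigP_rpow]; exact Real.exp_pos _
    rw [hxdef, Real.log_div hPz.ne' hy.ne', bigP_rpow, Real.log_exp, log_witness, hu]
    field_simp
  have hlogx_le : Real.log x ≤ -(ell D ^ 10)⁻¹ := by
    rw [hlogx]
    have hzu : z - uOf D (bigP D ^ (0.504 : ℝ) * etaPM D (-1)) ≤ -(ell D ^ 19)⁻¹ := by
      rw [hu] at hzb ⊢; linarith
    have h9 : (0 : ℝ) < ell D ^ 9 := by positivity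
    calc (z - uOf D (bigP D ^ (0.504 : ℝ) * etaPM D (-1))) * ell D ^ 9
        ≤ -(ell D ^ 19)⁻¹ * ell D ^ 9 := by
          exact mul_le_mul_of_nonneg_right hzu h9.le
      _ = -(ell D ^ 10)⁻¹ := by
          rw [neg_mul, neg_inj, show (19 : ℕ) = 10 + 9 from rfl, pow_add, mul_inv,
            mul_assoc, inv_mul_cancel₀ (by positivity : (ell D ^ 9 : ℝ) ≠ 0), mul_one]
  have hx1 : x ≤ 1 := by
    have hneg : Real.log x ≤ 0 :=
      le_trans hlogx_le (neg_nonpos.mpr (by positivity))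
    exact (Real.log_nonpos_iff hx.le).mp hneg
  -- (4.3): `g(x) ≤ ½exp(−𝓛³⁰·log²x) ≤ ½exp(−𝓛¹⁰)`
  have hg := GaussWeight.gWeight_le hΛ hx hx1
  have hsq : (ell D ^ 10)⁻¹ ^ 2 ≤ Real.log x ^ 2 := by
    have h1 : (ell D ^ 10)⁻¹ ≤ -Real.log x := by linarith
    have h0 : (0 : ℝ) ≤ (ell D ^ 10)⁻¹ := by positivity
    calc (ell D ^ 10)⁻¹ ^ 2 ≤ (-Real.log x) ^ 2 := by
          exact pow_le_pow_left₀ h0 h1 2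
      _ = Real.log x ^ 2 := by ring
  have hexp : ell D ^ 30 * (ell D ^ 10)⁻¹ ^ 2 ≤ ell D ^ 30 * Real.log x ^ 2 :=
    mul_le_mul_of_nonneg_left hsq hΛ.le
  have hpow : ell D ^ 30 * (ell D ^ 10)⁻¹ ^ 2 = ell D ^ 10 := by
    have hL0 : ell D ≠ 0 := hL.ne'
    field_simp
  have hgW : gW D x ≤ (1 / 2) * Real.exp (-(ell D ^ 10)) := by
    rw [gW]
    refine le_trans hg ?_
    have : -(ell D ^ 30) * Real.log x ^ 2 ≤ -(ell D ^ 10) := by nlinarith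
    exact mul_le_mul_of_nonneg_left (Real.exp_le_exp.2 this) (by norm_num)
  have hgW0 : (0 : ℝ) ≤ gW D x := by
    rw [gW]; exact (GaussWeight.gWeight_pos hΛ x).le
  rw [Real.norm_eq_abs, abs_of_nonneg hgW0]
  exact hgW

/-- **`Z22:§11.u014` AS PRINTED is false** — kernel refutation of `Typed.Sec11A.StepU014`
(G-num6-1, class printed-false-pointwise): for every claimed `c > 0`, `C` and every threshold
`D₀` there is an odd prime `p ≥ D₀` (with its quadratic primitive character `(·/p) ⊗ ℂ`) and the
case-B point `y = P^{0.504}η₋` at which the printed display misses by `≥ 0.0005` while the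
allowance `C·exp(−c𝓛¹⁰)` is `< 0.0005`. The corrected reading `StepU014corr` (what the case-B
assembly of (11.2) consumes) is untouched and is the discharge lane's. No statement about
Lemma 11.1, (11.2), Theorems 1–2 or Landau–Siegel zeros.
[cite: Zhang2022LandauSiegel, §11 p. 64, tex L3270–L3273; §4 (4.3)] -/
theorem not_stepU014 : ¬ StepU014 := by
  rintro ⟨c, hc, C, D₀, hAll⟩
  -- threshold: `𝓛 ≥ A` makes the analytic bounds and the allowance bound bite
  set A : ℝ := max 2000 (4001 * max C 1 / c) with hA
  have hA2000 : (2000 : ℝ) ≤ A := le_max_left _ _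
  obtain ⟨p, hpge, hp⟩ := Nat.exists_infinite_primes (max D₀ (⌈Real.exp A⌉₊ + 1))
  haveI : Fact p.Prime := ⟨hp⟩
  haveI : NeZero p := ⟨hp.ne_zero⟩
  have hpD₀ : D₀ ≤ p := le_trans (le_max_left _ _) hpge
  have hpreal : Real.exp A < (p : ℝ) := by
    have h1 : (⌈Real.exp A⌉₊ + 1 : ℕ) ≤ p := le_trans (le_max_right _ _) hpge
    have h2 : Real.exp A ≤ (⌈Real.exp A⌉₊ : ℝ) := Nat.le_ceil _
    have h3 : ((⌈Real.exp A⌉₊ + 1 : ℕ) : ℝ) ≤ (p : ℝ) := by exact_mod_cast h1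
    push_cast at h3
    linarith
  have hLA : A ≤ ell p := by
    rw [ell]
    calc A = Real.log (Real.exp A) := (Real.log_exp A).symm
      _ ≤ Real.log p := Real.log_le_log (Real.exp_pos A) hpreal.le
  have h2000 : (2000 : ℝ) ≤ ell p := le_trans hA2000 hLA
  have hL : (0 : ℝ) < ell p := by linarith
  have hL1 : (1 : ℝ) ≤ ell p := by linarith
  -- `p` is odd: `p > exp A ≥ exp 2000 ≥ 2001`
  have hp2 : p ≠ 2 := by
    have hbig : (2001 : ℝ) ≤ Real.exp A := by
      have h1 := Real.add_one_le_exp (2000 : ℝ)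
      have h2 := Real.exp_le_exp.2 hA2000
      linarith
    intro h
    rw [h] at hpreal
    norm_num at hpreal
    linarith
  -- the witness character and the instantiated printed claim
  have hbody := hAll p ((quadraticChar (ZMod p)).ringHomComp (Int.castRingHom ℂ)) hpD₀
    (isQuadratic_quadraticChar_ringHomComp p) (isPrimitive_quadraticChar_ringHomComp p hp2)
  have hy := hbody (bigP p ^ (0.504 : ℝ) * etaPM p (-1)) (witness_caseB p h2000)
  -- analytic lower bound on the defect
  have hu := uOf_witness p hL
  have h19 : (0 : ℝ) < ell p ^ 19 := by positivity
  have h2000p : (2000 : ℝ) ≤ ell p ^ 19 := le_trans h2000 (le_self_pow₀ hL1 (by norm_num))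
  have hinv19 : (ell p ^ 19)⁻¹ ≤ 1 / 2000 := by
    rw [inv_le_comm₀ h19 (by norm_num)]; linarith
  have h10 : (2000 : ℝ) ≤ ell p ^ 10 := le_trans h2000 (le_self_pow₀ hL1 (by norm_num))
  have hexp10 : Real.exp (-(ell p ^ 10)) ≤ 1 / 2 := by
    have h1 : Real.exp (-(ell p ^ 10)) ≤ Real.exp (-2000) := Real.exp_le_exp.2 (by linarith)
    have h2 : Real.exp (-2000 : ℝ) ≤ 1 / 2 := by
      rw [Real.exp_neg]
      have h3 : (2 : ℝ) ≤ Real.exp 2000 := by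
        have := Real.add_one_le_exp (2000 : ℝ); linarith
      rw [inv_le_comm₀ (by positivity) (by norm_num)]
      linarith
    linarith
  -- the interval-integral bound
  have hint : ‖∫ z in (0.502 : ℝ)..(2 * uOf p (bigP p ^ (0.504 : ℝ) * etaPM p (-1)) - 0.504),
      gW p (bigP p ^ z / (bigP p ^ (0.504 : ℝ) * etaPM p (-1)))‖ ≤
      (1 / 2) * Real.exp (-(ell p ^ 10)) *
        |(2 * uOf p (bigP p ^ (0.504 : ℝ) * etaPM p (-1)) - 0.504) - 0.502| :=
    intervalIntegral.norm_integral_le_of_norm_le_const fun z hz => integrand_le p h2000 hz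
  have habs : |(2 * uOf p (bigP p ^ (0.504 : ℝ) * etaPM p (-1)) - 0.504) - 0.502| ≤ 0.002 := by
    have hpos : (0 : ℝ) ≤ (ell p ^ 19)⁻¹ := by positivity
    rw [hu, abs_le]; constructor <;> nlinarith [hpos, hinv19]
  have hint' : |∫ z in (0.502 : ℝ)..(2 * uOf p (bigP p ^ (0.504 : ℝ) * etaPM p (-1)) - 0.504),
      gW p (bigP p ^ z / (bigP p ^ (0.504 : ℝ) * etaPM p (-1)))| ≤ 0.0005 := by
    rw [← Real.norm_eq_abs]
    refine le_trans hint ?_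
    have h0 : (0 : ℝ) ≤ (1 / 2) * Real.exp (-(ell p ^ 10)) := by positivity
    calc (1 / 2) * Real.exp (-(ell p ^ 10)) *
          |(2 * uOf p (bigP p ^ (0.504 : ℝ) * etaPM p (-1)) - 0.504) - 0.502|
        ≤ (1 / 2) * Real.exp (-(ell p ^ 10)) * 0.002 := by
          exact mul_le_mul_of_nonneg_left habs h0
      _ ≤ (1 / 2) * (1 / 2) * 0.002 := by nlinarith [Real.exp_pos (-(ell p ^ 10))]
      _ ≤ 0.0005 := by norm_num
  -- the main term is `≥ 0.001`
  have hmain : (0.001 : ℝ) ≤ 2 * uOf p (bigP p ^ (0.504 : ℝ) * etaPM p (-1)) - 1.006 := by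
    rw [hu]; nlinarith [hinv19]
  -- the defect is `≥ 0.0005`
  have hdefect : (0.0005 : ℝ) ≤
      |(∫ z in (0.502 : ℝ)..(2 * uOf p (bigP p ^ (0.504 : ℝ) * etaPM p (-1)) - 0.504),
        gW p (bigP p ^ z / (bigP p ^ (0.504 : ℝ) * etaPM p (-1)))) -
        (2 * uOf p (bigP p ^ (0.504 : ℝ) * etaPM p (-1)) - 1.006)| := by
    set I := ∫ z in (0.502 : ℝ)..(2 * uOf p (bigP p ^ (0.504 : ℝ) * etaPM p (-1)) - 0.504),
      gW p (bigP p ^ z / (bigP p ^ (0.504 : ℝ) * etaPM p (-1)))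
    have hIle : I ≤ 0.0005 := le_trans (le_abs_self I) hint'
    have habs2 : |I - (2 * uOf p (bigP p ^ (0.504 : ℝ) * etaPM p (-1)) - 1.006)| =
        (2 * uOf p (bigP p ^ (0.504 : ℝ) * etaPM p (-1)) - 1.006) - I := by
      rw [abs_of_nonpos (by linarith)]
      ring
    rw [habs2]
    linarith
  -- the allowance is `< 0.0005`
  have hallow : C * Real.exp (-c * ell p ^ 10) < 0.0005 := by
    have hCpos : C ≤ max C 1 := le_max_left _ _
    have hmax1 : (1 : ℝ) ≤ max C 1 := le_max_right _ _
    have hcL : 4001 * max C 1 ≤ c * ell p ^ 10 := by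
      have h1 : 4001 * max C 1 / c ≤ A := le_max_right _ _
      have h2 : 4001 * max C 1 / c ≤ ell p := le_trans h1 hLA
      have h3 : c * (4001 * max C 1 / c) ≤ c * ell p := by
        exact mul_le_mul_of_nonneg_left h2 hc.le
      rw [mul_div_cancel₀ _ hc.ne'] at h3
      have h4 : c * ell p ≤ c * ell p ^ 10 := by
        have := le_self_pow₀ hL1 (show (10 : ℕ) ≠ 0 by norm_num)
        exact mul_le_mul_of_nonneg_left this hc.le
      linarith
    have hexpc : Real.exp (c * ell p ^ 10) ≥ 4001 * max C 1 := by
      have := Real.add_one_le_exp (c * ell p ^ 10)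
      linarith
    have hepos : (0 : ℝ) < Real.exp (c * ell p ^ 10) := Real.exp_pos _
    have h4001 : (0 : ℝ) < 4001 * max C 1 := by positivity
    calc C * Real.exp (-c * ell p ^ 10)
        ≤ max C 1 * Real.exp (-c * ell p ^ 10) := by
          have : (0 : ℝ) < Real.exp (-c * ell p ^ 10) := Real.exp_pos _
          exact mul_le_mul_of_nonneg_right hCpos this.le
      _ = max C 1 / Real.exp (c * ell p ^ 10) := by
          rw [neg_mul, Real.exp_neg, div_eq_mul_inv]
      _ ≤ max C 1 / (4001 * max C 1) := by
          exact div_le_div_of_nonneg_left (by positivity) h4001 hexpc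
      _ = 1 / 4001 := by
          rw [mul_comm, div_mul_eq_div_div, div_self (by positivity : max C 1 ≠ 0)]
      _ < 0.0005 := by norm_num
  -- contradiction
  have := le_trans hdefect hy
  linarith

end Literature.NumberTheory.LFunctions.Zhang2022.AdjTeamR
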